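import Summits.QuantumFields.BalabanUV.Beta.GAN24.WilsonSectorSourcePairingZero
import Summits.QuantumFields.BalabanUV.Beta.GAN24.CubicSectorLevelDown
import Summits.QuantumFields.BalabanUV.Beta.GAN24.MultiplierZeroMass
import Summits.QuantumFields.BalabanUV.Beta.KernelWardMColumn
import Summits.QuantumFields.BalabanUV.Beta.GAN24.ChargeTowerClimb
import Summits.QuantumFields.BalabanUV.Beta.GAN24.FieldResponseCoarseGradient

/-!
# `BalabanUV.Beta.GAN24.TwoLevelPairingIdentitiesEnd` — binder row G-an2-4 ∕ (CONV-C), the (S) row ∕ (W-γ) one level up, the induction's algebraic step, PART 5b: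
# **THE TWO-LEVEL IDENTITY (C1) `⟨Ψ⁺⊙H_{j+1}h, C_j(H_{j+1}n)⟩ = wVH_{j+1}⁻¹·⟨φ⁺⊙h, C_{j+1}n⟩ − (stepScale_{j+1} ∕ wVH_{j+1})·(C1′)_{j+1}(h; n; φ)` FOR GENERIC DATA**
# (G-an2-4 CRUX TEAM (2), seat `b2b-balaban-gan24-formalise-leaf-02` = SUPPLIER side of leaf-06's (C2′)∕`hX` mechanism, gen 61; PART 5b, INTENT 5 ∕ OFFER O-leaf02-g61-2 — the
# end-point-weight half of leaf-06 g50's `LEVELS-GE2.md` §2–§3 «two-level identities (C1)∕(C2)»; (C2) is the SIBLING file PART 5a `TwoLevelPairingIdentities` — the two files are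
# import-independent of each other)

NOT IN PRINT; OUR BOOKKEEPING ([folklore] BY NAME over leaf-06 g50 `FieldResponseCoarseGradient.multResponse_fieldResponse_eq` (`wVH_{j+1}·C_j ∘ H_{j+1} = stepScale_{j+1}·𝒬ᵀ_{Lc} ∘ C_{j+1}`),
`KernelWardMColumn.colM_coDressKBmAt` ⨾ `MultiplierZeroMass.colM_KInvStep` ∕ `hasSum_colM_KInvStep_bond`, `ChargeTowerClimb.abs_tsum_sum_wΦ_mul_le`, PART 4a `WilsonSectorGaugeLegUnfolding.tsum_mul_contourSumAdj_of_summable` (adjointness of `𝒬`, summable fine side) ∕ `summable_abs_partialContour`, leaf-06 g49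
(α) `BlockWeightContourCommutation.contourSum_endWeight_mul`, leaf-06 g49 (ε-Λ) `LambdaSlotWeightsTwoLevel.contourSum_fieldResponse`, leaf-06 g50 `CubicSectorLevelDown.summable_fieldResponse`;
0 `def`, 0 cited fact, 0 `def … : Prop`, 0 sorry).
HONEST FRAMING (cell contract, verbatim): «discharging `BetaPertH` makes Bałaban's UV stability UNCONDITIONAL — a real constructive-QFT result; it is NOT the continuum limit and NOT
the Clay problem.»  HONEST DEPENDENCY (verbatim): «continuum YM on T⁴ ⇐ BetaPertH ∧ nine spine estimates (0/9 proved); BetaPertH ⇐ (D1) ∧ (D4) ∧ CAP+tail; G-an2-4 gates asym,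
D1 and NE2/3/4.»

WHY.  See PART 5a.  With `Ψ = φ ∘ blk` and `P = Ψ⁺ ⊙ H_{j+1}h` (absolutely summable: `h` summable along every direction), leaf-06 g50's link turns `C_j(H_{j+1}n)` into
`(stepScale_{j+1} ∕ wVH_{j+1})·𝒬ᵀ_{Lc}(C_{j+1}n)`, adjointness gives `⟨𝒬 P, C_{j+1}n⟩`, (α) splits `𝒬(Ψ⁺⊙v) = φ⁺·𝒬v − dφ·EI_{Lc}v`, and `𝒬(H_{j+1}h) = stepScale_{j+1}⁻¹·h`: the main term
`wVH_{j+1}⁻¹·⟨φ⁺⊙h, C_{j+1}n⟩` and PART 2's border object `(C1′)_{j+1}(h; n; φ) = Σ'_Y Σ_κ (C_{j+1}n)(κ,Y)·dzφ κ Y·EI_{Lc}(H_{j+1}h)(κ,Y)` (slot-summed, GENERIC `h`) with coefficient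
`−stepScale_{j+1} ∕ wVH_{j+1}`.  READING (for F2∕F3, not proved here): at Bałaban's pins the `(C1′)_{j+1}` produced here by the cubic sector and the one of the border sector (PART 2 at level
`j+1`) are set to cancel exactly as at level 0 (PART 4b's READING), leaving `(C2′)_{j+1}` and the lower-level defects to F1.
* §0 `summable_bdd_mul_colM`, `abs_multResponse_le'` (`∃ BC, |C_k n| ≤ BC` for bounded `n`, every root, every `k`).
* §1 `abs_contourSumAdj_le`, **`pairing_endWeight_fieldResponse_multResponse_eq`** = (C1) at the centred root (statement in the title).
Asserts NO value of any resolvent column beyond (E3), the averaging constraint and the zero mass of the tents; NOTHING of `hX` at `j ≥ 1` ∕ (W-γ) at levels ≥ 1 ∕ (S) above level 0 ∕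
F1 ∕ F2 ∕ F3 discharged; NEVER «G-an2-4 closed» as (CONV-C); NOT D1, NOT `BetaPertH`, NOT continuum, NOT Clay.  2026-08-23; no existing file touched.
-/

noncomputable section

open Finset
open scoped BigOperators
open Literature.MathematicalPhysics.QuantumFieldTheory
open Literature.MathematicalPhysics.QuantumFieldTheory.Balaban1983to89
open Literature.MathematicalPhysics.QuantumFieldTheory.Balaban1983to89.Beta
open LatticeForm (quo)
open B12Sec2to5 (l1 l1_nonneg)
open ExpKernelCalculus (Site MKer Decays Zl summable_exp_shift')
open OneStepResolventKernel (Fib)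
open AffineAveraging (Form0 Form1 box toSite unitVec unitVec_apply dz contourSum)
open AffineReproduction (contourSumAdj)
open KKTFluctuationEnergy (contourSumAdj_eq)
open AveragingContours (blk)
open AveragingContoursRooted (ctrOff ctrOff_mem_box)
open KernelSpecInstance (wΦ)
open OneStepKernelFamily (KInvStep colH)
open SecondOrderResponse (colM)
open BalabanStepJetsSucc (wVH)
open Summit.QuantumFields.BalabanUV.Beta.AxialDressingRooted (coDressKBmAt decays_coDressKBmAt_KInvStep one_le_of_neZero)
open Summit.QuantumFields.BalabanUV.Beta.BorderedHessian (stepScale stepScale_ne_zero)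
open Summit.QuantumFields.BalabanUV.Beta.LagrangeFoldStep (wVH_ne_zero)
open Summit.QuantumFields.BalabanUV.Beta.KernelWardMColumn (colM_coDressKBmAt)
open Summit.QuantumFields.BalabanUV.Beta.GAN24.MultiplierZeroMass (colM_KInvStep hasSum_colM_KInvStep_bond summable_wΦ)
open Summit.QuantumFields.BalabanUV.Beta.GAN24.ChargeTowerClimb (abs_tsum_sum_wΦ_mul_le)
open Summit.QuantumFields.BalabanUV.Beta.GAN24.ContactCellRefine (summable_comp_quo')
open Summit.QuantumFields.BalabanUV.Beta.GAN24.DataColumnCombRows (E2row_colH_eq_contourSumAdj_colM_succ)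
open Summit.QuantumFields.BalabanUV.Beta.GAN24.RelInvWardPairing (summable_bdd_mul tsum_mul_contourSumAdj_bdd)
open Summit.QuantumFields.BalabanUV.Beta.GAN24.BornLambdaVertexTent (summable_wΦ_shift)
open Summit.QuantumFields.BalabanUV.Beta.GAN24.CubicPushGaugeLegUnfoldingFF (abs_fieldResponse_le')
open Summit.QuantumFields.BalabanUV.Beta.GAN24.CubicSectorLevelDown (summable_fieldResponse summable_uncurry_mul_decay_mul_bdd)
open Summit.QuantumFields.BalabanUV.Beta.GAN24.WilsonSectorGaugeLegUnfolding (tsum_mul_contourSumAdj_of_summable summable_abs_contourSum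
  summable_abs_partialContour tsum_fieldResponse_mul_eq tsum_multResponse_mul_eq)
open Summit.QuantumFields.BalabanUV.Beta.GAN24.BlockWeightContourCommutation (contourSum_endWeight_mul contourSum_bondSum_mul)
open Summit.QuantumFields.BalabanUV.Beta.GAN24.LambdaSlotWeightsTwoLevel (contourSum_fieldResponse)
open Summit.QuantumFields.BalabanUV.Beta.GAN24.FieldResponseCoarseGradient (multResponse_fieldResponse_eq)

namespace Summit.QuantumFields.BalabanUV.Beta.GAN24.TwoLevelPairingIdentitiesEnd

variable {d : ℕ}

/-! ## §0 The multiplier response of a bounded datum is bounded -/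

section Bounds
variable {Lc : ℕ} [NeZero Lc]

/-- [folklore] The tent column `w ↦ colM G_k Lc κ₀ w κ Y` (zero total mass, `MultiplierZeroMass.hasSum_colM_KInvStep_bond`) is absolutely summable, and so is every bounded
multiple of it. -/
theorem summable_bdd_mul_colM (ρ : Site (d + 1)) (k : ℕ) {n : Form1 (d + 1) ℝ} {Bn : ℝ} (hn : ∀ κ u, |n κ u| ≤ Bn) (κ₀ κ : Fin (d + 1)) (Y : Site (d + 1)) :
    Summable fun w : Site (d + 1) => n κ₀ w * colM (coDressKBmAt ρ Lc (KInvStep (d := d) Lc k)) Lc κ₀ w κ Y := by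
  have hs : Summable fun w : Site (d + 1) => |colM (coDressKBmAt ρ Lc (KInvStep (d := d) Lc k)) Lc κ₀ w κ Y| := by
    simp only [colM_coDressKBmAt]
    exact (hasSum_colM_KInvStep_bond (d := d) (Lc := Lc) k κ₀ κ Y).summable.abs
  exact summable_bdd_mul (hn κ₀) hs

/-- [folklore] **THE MULTIPLIER RESPONSE OF A BOUNDED DATUM IS BOUNDED** (every root, every level `k`): `|(C_k n)(κ,Y)| ≤ BC` uniformly — the tent columns are the summable `wΦ_{Lc^{k+1}}`
(`ChargeTowerClimb.abs_tsum_sum_wΦ_mul_le`). -/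
theorem abs_multResponse_le' (ρ : Site (d + 1)) (k : ℕ) {n : Form1 (d + 1) ℝ} {Bn : ℝ} (hn : ∀ κ u, |n κ u| ≤ Bn) :
    ∃ BC : ℝ, 0 ≤ BC ∧ ∀ (κ : Fin (d + 1)) (Y : Site (d + 1)),
      |∑ κ₀, ∑' w : Site (d + 1), n κ₀ w * colM (coDressKBmAt ρ Lc (KInvStep (d := d) Lc k)) Lc κ₀ w κ Y| ≤ BC := by
  have hBn : 0 ≤ Bn := (abs_nonneg _).trans (hn 0 0)
  set S : Fin (d + 1) → ℝ := fun κ => ∑ l : Fin (d + 1), ∑' z : Site (d + 1), |wΦ (N := Lc ^ (k + 1)) (d := d) κ l z| with hS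
  have hS0 : ∀ κ, 0 ≤ S κ := fun κ => Finset.sum_nonneg fun l _ => tsum_nonneg fun _ => abs_nonneg _
  refine ⟨Bn * ∑ κ, S κ, mul_nonneg hBn (Finset.sum_nonneg fun κ _ => hS0 κ), fun κ Y => ?_⟩
  have hsw : ∀ κ₀, Summable fun w : Site (d + 1) => n κ₀ w * colM (coDressKBmAt ρ Lc (KInvStep (d := d) Lc k)) Lc κ₀ w κ Y :=
    fun κ₀ => summable_bdd_mul_colM ρ k hn κ₀ κ Y
  have e : (∑ κ₀, ∑' w : Site (d + 1), n κ₀ w * colM (coDressKBmAt ρ Lc (KInvStep (d := d) Lc k)) Lc κ₀ w κ Y)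
      = ∑' w : Site (d + 1), ∑ κ₀, wΦ (N := Lc ^ (k + 1)) κ κ₀ (Y - w) * n κ₀ w := by
    rw [← Summable.tsum_finsetSum (fun κ₀ _ => hsw κ₀)]
    refine tsum_congr fun w => Finset.sum_congr rfl fun κ₀ _ => ?_
    rw [colM_coDressKBmAt, colM_KInvStep, mul_comm]
  rw [e]
  calc |∑' w : Site (d + 1), ∑ κ₀, wΦ (N := Lc ^ (k + 1)) κ κ₀ (Y - w) * n κ₀ w| ≤ Bn * S κ := abs_tsum_sum_wΦ_mul_le (Lc ^ (k + 1)) hn κ Y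
    _ ≤ Bn * ∑ κ', S κ' := mul_le_mul_of_nonneg_left (Finset.single_le_sum (fun κ' _ => hS0 κ') (Finset.mem_univ κ)) hBn

end Bounds

/-! ## §1 The two-level identity (C1): `⟨Ψ⁺⊙H_{j+1}h, C_j(H_{j+1}n)⟩ = wVH_{j+1}⁻¹·⟨φ⁺⊙h, C_{j+1}n⟩ − (stepScale_{j+1}∕wVH_{j+1})·(C1′)_{j+1}(h; n; φ)` -/

section C1
variable {Lc : ℕ} [NeZero Lc]

/-- [folklore] The adjoint contour stencil of a bounded coarse 1-form is bounded by `N·B` (`N` terms). -/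
theorem abs_contourSumAdj_le {N : ℕ} {φ : Form1 (d + 1) ℝ} {B : ℝ} (hφ : ∀ κ Y, |φ κ Y| ≤ B) (κ : Fin (d + 1)) (u : Site (d + 1)) :
    |contourSumAdj N φ κ u| ≤ (N : ℝ) * B := by
  rw [contourSumAdj_eq]
  refine (Finset.abs_sum_le_sum_abs _ _).trans ?_
  refine (Finset.sum_le_sum fun s _ => hφ κ _).trans ?_
  rw [Finset.sum_const, Finset.card_range, nsmul_eq_mul]

/-- NOT IN PRINT; OUR BOOKKEEPING.  **THE TWO-LEVEL IDENTITY (C1)** (centred root `ρ = toSite (ctrOff (d+1) Lc)`, every `j`; `h` summable along every direction, `n` bounded, `φ` a bounded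
coarse potential, `Ψ = φ ∘ blk`, `Ψ⁺(a,v) = Ψ(v + e_a)`; `G_k = coDressKBmAt ρ Lc (KInvStep Lc k)`, `H_{j+1} m (a,v) = Σ_κ₀ Σ'_w m κ₀ w·colH G_{j+1} Lc κ₀ w a v`,
`(C_k m)(κ,Y) = Σ_κ₀ Σ'_w m κ₀ w·colM G_k Lc κ₀ w κ Y` — datum first, as in PART 4b and leaf-06 g50's `sourcePairing_levelOne_closed`; PART 2 writes the same object with the two
coarse bonds of `colM` exchanged, equal by PART 4a `colM_coDressKBmAt_KInvStep_swap`):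
`Σ_a Σ'_v (H_{j+1}h)(a,v)·Ψ⁺(a,v)·(C_j(H_{j+1}n))(a,v) = wVH_{j+1}⁻¹·Σ_l Σ'_t h l t·φ(t + e_l)·(C_{j+1}n)(l,t) − (stepScale_{j+1}∕wVH_{j+1})·Σ'_Y Σ_κ (C_{j+1}n)(κ,Y)·dzφ κ Y·EI_{Lc}(H_{j+1}h)(κ,Y)`
— the last term is PART 2's border object `(C1′)_{j+1}(h; n; φ)` (slot-summed) for GENERIC `h`.  Mechanism = PART 4b's one level up: leaf-06 g50's link `C_j∘H_{j+1} = (s∕w)·𝒬ᵀ∘C_{j+1}` (`FieldResponseCoarseGradient`),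
adjointness of `𝒬` (PART 4a `tsum_mul_contourSumAdj_of_summable`), (α) `contourSum_endWeight_mul`, the averaging constraint `𝒬(H_{j+1}h) = stepScale_{j+1}⁻¹·h` ((ε-Λ) `contourSum_fieldResponse`). -/
theorem pairing_endWeight_fieldResponse_multResponse_eq (j : ℕ) {h : Form1 (d + 1) ℝ} (hh : ∀ l, Summable (h l)) {n : Form1 (d + 1) ℝ} {Bn : ℝ}
    (hn : ∀ κ u, |n κ u| ≤ Bn) {φ : Site (d + 1) → ℝ} {Bφ : ℝ} (hφ : ∀ y, |φ y| ≤ Bφ) :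
    ∑ a, ∑' v : Site (d + 1),
        (∑ l, ∑' t : Site (d + 1), h l t * colH (coDressKBmAt (toSite (ctrOff (d + 1) Lc)) Lc (KInvStep (d := d) Lc (j + 1))) Lc l t a v)
          * (φ (blk Lc (v + unitVec a))
            * ∑ κ₀, ∑' w : Site (d + 1),
                (∑ κ₁, ∑' x : Site (d + 1), n κ₁ x * colH (coDressKBmAt (toSite (ctrOff (d + 1) Lc)) Lc (KInvStep (d := d) Lc (j + 1))) Lc κ₁ x κ₀ w)
                  * colM (coDressKBmAt (toSite (ctrOff (d + 1) Lc)) Lc (KInvStep (d := d) Lc j)) Lc κ₀ w a v)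
      = (wVH d Lc (j + 1))⁻¹ * ∑ l, ∑' t : Site (d + 1), h l t
            * (φ (t + unitVec l) * ∑ κ₀, ∑' w : Site (d + 1), n κ₀ w * colM (coDressKBmAt (toSite (ctrOff (d + 1) Lc)) Lc (KInvStep (d := d) Lc (j + 1))) Lc κ₀ w l t)
        - stepScale d Lc (j + 1) / wVH d Lc (j + 1) * ∑' Y : Site (d + 1), ∑ κ : Fin (d + 1),
            (∑ κ₀, ∑' w : Site (d + 1), n κ₀ w * colM (coDressKBmAt (toSite (ctrOff (d + 1) Lc)) Lc (KInvStep (d := d) Lc (j + 1))) Lc κ₀ w κ Y)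
              * (dz φ κ Y * ∑ b ∈ box (d + 1) Lc, ∑ s ∈ Finset.range Lc, (if b κ + s + 1 < Lc then
                  (∑ l, ∑' t : Site (d + 1), h l t * colH (coDressKBmAt (toSite (ctrOff (d + 1) Lc)) Lc (KInvStep (d := d) Lc (j + 1))) Lc l t κ
                    ((Lc : ℤ) • Y + toSite b + (s : ℤ) • unitVec κ)) else 0)) := by
  classical
  have hLc1 : 1 ≤ Lc := one_le_of_neZero Lc
  have hr := ctrOff_mem_box (d := d + 1) hLc1
  have hBφ : 0 ≤ Bφ := (abs_nonneg _).trans (hφ 0)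
  have hs : stepScale d Lc (j + 1) ≠ 0 := stepScale_ne_zero (j + 1)
  have hhB : ∀ l t, |h l t| ≤ ∑ l' : Fin (d + 1), ∑' t' : Site (d + 1), |h l' t'| := fun l t =>
    ((hh l).abs.le_tsum t (fun _ _ => abs_nonneg _)).trans
      (Finset.single_le_sum (f := fun l' => ∑' t' : Site (d + 1), |h l' t'|) (fun l' _ => tsum_nonneg fun _ => abs_nonneg _) (Finset.mem_univ l))
  have hw : wVH d Lc (j + 1) ≠ 0 := wVH_ne_zero (j + 1)
  obtain ⟨BC, hBC0, hCnb⟩ := abs_multResponse_le' (d := d) (Lc := Lc) (toSite (ctrOff (d + 1) Lc)) (j + 1) hn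
  -- (A₀) leaf-06 g50's link between the two levels (`wVH_{j+1}·C_j(H_{j+1}n) = stepScale_{j+1}·𝒬ᵀ(C_{j+1}n)`)
  have hA0 := fun (a : Fin (d + 1)) (v : Site (d + 1)) => multResponse_fieldResponse_eq (d := d) (Lc := Lc) j hn a v
  have hHs : ∀ a, Summable fun v : Site (d + 1) => ∑ l, ∑' t : Site (d + 1), h l t
      * colH (coDressKBmAt (toSite (ctrOff (d + 1) Lc)) Lc (KInvStep (d := d) Lc (j + 1))) Lc l t a v := fun a => summable_fieldResponse hr (j + 1) hh a
  -- abbreviations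
  set G' : MKer (d + 1) (Fib d) := coDressKBmAt (toSite (ctrOff (d + 1) Lc)) Lc (KInvStep (d := d) Lc (j + 1)) with hG'
  set G : MKer (d + 1) (Fib d) := coDressKBmAt (toSite (ctrOff (d + 1) Lc)) Lc (KInvStep (d := d) Lc j) with hG
  set Hh : Form1 (d + 1) ℝ := fun a v => ∑ l, ∑' t : Site (d + 1), h l t * colH G' Lc l t a v with hHh
  set Hn : Form1 (d + 1) ℝ := fun κ u => ∑ κ₁, ∑' x : Site (d + 1), n κ₁ x * colH G' Lc κ₁ x κ u with hHn
  set Cn : Form1 (d + 1) ℝ := fun κ Y => ∑ κ₀, ∑' w : Site (d + 1), n κ₀ w * colM G' Lc κ₀ w κ Y with hCn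
  set P : Form1 (d + 1) ℝ := fun a v => φ (blk Lc (v + unitVec a)) * Hh a v with hP
  set c : ℝ := stepScale d Lc (j + 1) / wVH d Lc (j + 1) with hc
  show ∑ a, ∑' v : Site (d + 1), Hh a v * (φ (blk Lc (v + unitVec a)) * ∑ κ₀, ∑' w : Site (d + 1), Hn κ₀ w * colM G Lc κ₀ w a v)
      = (wVH d Lc (j + 1))⁻¹ * ∑ l, ∑' t : Site (d + 1), h l t * (φ (t + unitVec l) * Cn l t)
        - c * ∑' Y : Site (d + 1), ∑ κ : Fin (d + 1), Cn κ Y * (dz φ κ Y * ∑ b ∈ box (d + 1) Lc, ∑ s ∈ Finset.range Lc,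
            (if b κ + s + 1 < Lc then Hh κ ((Lc : ℤ) • Y + toSite b + (s : ℤ) • unitVec κ) else 0))
  have hCnb' : ∀ κ Y, |Cn κ Y| ≤ BC := hCnb
  have hHs' : ∀ a, Summable fun v : Site (d + 1) => |Hh a v| := fun a => (hHs a).abs
  have hPs : ∀ a, Summable fun v : Site (d + 1) => |P a v| := fun a =>
    (summable_bdd_mul (f := fun v => φ (blk Lc (v + unitVec a))) (fun v => hφ _) (hHs' a)).abs
  -- (A) the link between the two levels, under the integral
  have hA : ∀ a v, (∑ κ₀, ∑' w : Site (d + 1), Hn κ₀ w * colM G Lc κ₀ w a v) = c * contourSumAdj Lc Cn a v :=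
    fun a v => by
      rw [hc, div_mul_eq_mul_div, eq_div_iff hw, mul_comm]
      exact hA0 a v
  simp only [hA]
  -- (B) the finite direction sum inside, the constant out, the summable form to the left
  have hQb : ∀ a v, |φ (blk Lc (v + unitVec a)) * (c * contourSumAdj Lc Cn a v)| ≤ Bφ * (|c| * ((Lc : ℝ) * BC)) := fun a v => by
    rw [abs_mul, abs_mul]
    exact mul_le_mul (hφ _) (mul_le_mul_of_nonneg_left (abs_contourSumAdj_le hCnb' a v) (abs_nonneg _)) (by positivity) hBφ
  have hsa : ∀ a, Summable fun v : Site (d + 1) => Hh a v * (φ (blk Lc (v + unitVec a)) * (c * contourSumAdj Lc Cn a v)) := fun a =>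
    (summable_bdd_mul (hQb a) (hHs' a)).congr fun v => mul_comm _ _
  have eB : (∑ a, ∑' v : Site (d + 1), Hh a v * (φ (blk Lc (v + unitVec a)) * (c * contourSumAdj Lc Cn a v)))
      = c * ∑' v : Site (d + 1), ∑ a, P a v * contourSumAdj Lc Cn a v := by
    rw [← Summable.tsum_finsetSum (fun a _ => hsa a), ← tsum_mul_left]
    refine tsum_congr fun v => ?_
    rw [Finset.mul_sum]
    exact Finset.sum_congr rfl fun a _ => by simp only [hP]; ring
  rw [eB]
  -- (C) adjointness of the contour block sum (summable fine form, bounded coarse form)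
  rw [tsum_mul_contourSumAdj_of_summable hPs hCnb']
  -- (D) the end-point weight through the contour sum, the averaging constraint of the field response
  have hQ : ∀ κ (Y : Site (d + 1)), contourSum Lc Hh κ Y = (stepScale d Lc (j + 1))⁻¹ * h κ Y := fun κ Y => by
    rw [hHh, hG']
    exact contourSum_fieldResponse (j + 1) hhB κ Y
  have eD : ∀ κ (Y : Site (d + 1)), contourSum Lc P κ Y
      = φ (Y + unitVec κ) * ((stepScale d Lc (j + 1))⁻¹ * h κ Y)
        - dz φ κ Y * ∑ b ∈ box (d + 1) Lc, ∑ s ∈ Finset.range Lc, (if b κ + s + 1 < Lc then Hh κ ((Lc : ℤ) • Y + toSite b + (s : ℤ) • unitVec κ) else 0) := by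
    intro κ Y
    rw [hP, contourSum_endWeight_mul hLc1 φ Hh κ Y, hQ]
  simp only [eD]
  -- (E) split; constants
  have hb1 : ∀ κ (Y : Site (d + 1)), |Cn κ Y * (φ (Y + unitVec κ) * (stepScale d Lc (j + 1))⁻¹)| ≤ BC * (Bφ * |(stepScale d Lc (j + 1))⁻¹|) := by
    intro κ Y
    rw [abs_mul, abs_mul]
    exact mul_le_mul (hCnb' κ Y) (mul_le_mul_of_nonneg_right (hφ _) (abs_nonneg _)) (by positivity) hBC0
  have hF1 : ∀ κ, Summable fun Y : Site (d + 1) => Cn κ Y * (φ (Y + unitVec κ) * ((stepScale d Lc (j + 1))⁻¹ * h κ Y)) := fun κ =>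
    (summable_bdd_mul (hb1 κ) (hh κ).abs).congr fun Y => by ring
  have hb2 : ∀ κ (Y : Site (d + 1)), |Cn κ Y * dz φ κ Y| ≤ BC * (2 * Bφ) := fun κ Y => by
    rw [abs_mul]; exact mul_le_mul (hCnb' κ Y) (KKTFluctuationEnergy.abs_dz_le hφ κ Y) (abs_nonneg _) hBC0
  have hF2 : ∀ κ, Summable fun Y : Site (d + 1) => Cn κ Y * (dz φ κ Y * ∑ b ∈ box (d + 1) Lc, ∑ s ∈ Finset.range Lc,
      (if b κ + s + 1 < Lc then Hh κ ((Lc : ℤ) • Y + toSite b + (s : ℤ) • unitVec κ) else 0)) := fun κ =>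
    (summable_bdd_mul (hb2 κ) (summable_abs_partialContour hLc1 hHs' κ (fun b s => b κ + s + 1 < Lc))).congr fun Y => by ring
  have eE : ∀ Y : Site (d + 1), (∑ κ : Fin (d + 1), Cn κ Y * (φ (Y + unitVec κ) * ((stepScale d Lc (j + 1))⁻¹ * h κ Y)
        - dz φ κ Y * ∑ b ∈ box (d + 1) Lc, ∑ s ∈ Finset.range Lc, (if b κ + s + 1 < Lc then Hh κ ((Lc : ℤ) • Y + toSite b + (s : ℤ) • unitVec κ) else 0)))
      = (∑ κ : Fin (d + 1), Cn κ Y * (φ (Y + unitVec κ) * ((stepScale d Lc (j + 1))⁻¹ * h κ Y)))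
        - ∑ κ : Fin (d + 1), Cn κ Y * (dz φ κ Y * ∑ b ∈ box (d + 1) Lc, ∑ s ∈ Finset.range Lc,
            (if b κ + s + 1 < Lc then Hh κ ((Lc : ℤ) • Y + toSite b + (s : ℤ) • unitVec κ) else 0)) := by
    intro Y
    rw [← Finset.sum_sub_distrib]
    exact Finset.sum_congr rfl fun κ _ => by ring
  simp only [eE]
  rw [(summable_sum fun κ _ => hF1 κ).tsum_sub (summable_sum fun κ _ => hF2 κ), mul_sub]
  -- (F) the main term with the datum outside
  have e1 : (∑' Y : Site (d + 1), ∑ κ : Fin (d + 1), Cn κ Y * (φ (Y + unitVec κ) * ((stepScale d Lc (j + 1))⁻¹ * h κ Y)))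
      = (stepScale d Lc (j + 1))⁻¹ * ∑ l, ∑' t : Site (d + 1), h l t * (φ (t + unitVec l) * Cn l t) := by
    rw [Summable.tsum_finsetSum (fun κ _ => hF1 κ), Finset.mul_sum]
    refine Finset.sum_congr rfl fun κ _ => ?_
    rw [← tsum_mul_left]
    exact tsum_congr fun Y => by ring
  have e2 : c * (stepScale d Lc (j + 1))⁻¹ = (wVH d Lc (j + 1))⁻¹ := by
    rw [hc, div_mul_eq_mul_div, mul_inv_cancel₀ hs, one_div]
  rw [e1, ← mul_assoc, e2]

end C1

end Summit.QuantumFields.BalabanUV.Beta.GAN24.TwoLevelPairingIdentitiesEnd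

end
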